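import Literature.NumberTheory.LFunctions.WeilTwoPrimeOddMarginFBase
import Literature.NumberTheory.LFunctions.WeilBlockRows
import HarnessLib

/-!
# Two-prime odd-margin certificate F: rows 75–78 of the check `D C = I` (odd block)

Part of the odd-block check of `weilCert23F` (`WeilCert.checkDCRow`), `decide +kernel` row by row. Pure proof file; nothing is asserted.
-/

noncomputable section

namespace Literature.NumberTheory.LFunctions

set_option maxHeartbeats 0 in
/-- Kernel check of row 75 of `D C = I` (certificate F). [folklore] -/
theorem checkDCRow1_75_weilCert23F : weilCert23FBase.checkDCRow 1 75 = true := by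
  decide +kernel

set_option maxHeartbeats 0 in
/-- Kernel check of row 76 of `D C = I` (certificate F). [folklore] -/
theorem checkDCRow1_76_weilCert23F : weilCert23FBase.checkDCRow 1 76 = true := by
  decide +kernel

set_option maxHeartbeats 0 in
/-- Kernel check of row 77 of `D C = I` (certificate F). [folklore] -/
theorem checkDCRow1_77_weilCert23F : weilCert23FBase.checkDCRow 1 77 = true := by
  decide +kernel

set_option maxHeartbeats 0 in
/-- Kernel check of row 78 of `D C = I` (certificate F). [folklore] -/
theorem checkDCRow1_78_weilCert23F : weilCert23FBase.checkDCRow 1 78 = true := by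
  decide +kernel


end Literature.NumberTheory.LFunctions
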